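import Summits.BirchSwinnertonDyer.BirchSwinnertonDyer.Theorems.EisensteinPrimesAnomalousUnramifiedKernelFinite
import Literature.NumberTheory.EllipticCurves.Rubin1991.TwoVariableSelmerCoefficientTwist
import Literature.NumberTheory.EllipticCurves.BigRepModuleShapiroSelmerConditionsProofs
import Literature.NumberTheory.EllipticCurves.KellerYin2024.CharacterSelmerGroups
import Literature.NumberTheory.EllipticCurves.Agboola2007.RestrictedSelmerGroups
import Literature.NumberTheory.EllipticCurves.SubgroupSelmerCocycleCriteriaProofs
import HarnessLib

/-!
# Crux `PrintCf2.SplitBadTwoRankOneOfFacts` (stmt-BirchSwinnertonDyer-20368), road α v12/v13, stub S3d — the σ-BOOKKEEPING brick (DC), part 1 (generic):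
# over a `ℤ_p`-line RAMIFIED at `v̄`, «a condition at EVERY conjugate of the chosen place above `v̄`» is «the condition at `p^m` conjugates»,
# and the strict/unramified defect `S_M(K_∞)/𝔖_v̄(K_∞, M)` embeds in `Def^{p^m}`

Cell `bsd-print-cf2`, EXTRA WIDTH seat `bsd-line-cf2-p1-w8` g4 (prover-bsd-line-cf2-p1-w8-g4-0); LEAD ASSIGN 2026-08-29T02:30:44Z («(DC) σ-bookkeeping /
kernel-indexing brick of S3d»); `--supports stmt-BirchSwinnertonDyer-20368` (helper, Theses-free). HONEST FRAMING: nothing here closes the crux or a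
registered stub; BSD is not proved by any of this; no summit `Statement.lean` is touched; no `sorry`, no new axiom, no Literature fact, no definition.

## Why (S3d, LEAD g13 rulings 01:35Z/01:48Z/02:30Z; -w6 g4 01:04:39Z «(b2-iii) σ-bookkeeping», currency handshake 02:44:26Z)

Agboola's strict group `𝔖_v̄(K*_∞, W*)` and the unramified group `S_{W*}(K*_∞)` over the line `K*_∞ = K̄^{ker κ'}` impose their local condition at
`v̄` at EVERY conjugate `σ D_v̄ σ⁻¹` (`conjH1 σ`), i.e. at every prime of `K*_∞` above `v̄`. The primes of `K*_∞` above `v̄` are the double cosets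
`ker κ' \\ Γ_K / D_v̄ ≅ ℤ_p / κ'(D_v̄)`, FINITELY many because the line is RAMIFIED at `v̄`. This file proves that bookkeeping generically (any
number field `K`, prime `p`, `ℤ_p`-line `κ`, discrete module `M`, finite place `w`/`v̄`):

* `exists_eq_inertia_mul_pow_mul` — **(DC-1)**: if `τ₁ ∈ I_w` has `κ τ₁ ≠ 1` (valuation `m`) and `γ` is a topological generator (`κ γ = 1`),
  every `σ ∈ Γ_K` factors as `σ = τ · γⁿ · h` with `τ ∈ I_w`, `n < p^m`, `h ∈ ker κ` (`ℤ_p`-saturation of the closed subgroup `I_w`,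
  bsd-eis `AnomalousLocalTorsion.exists_mem_apply_toAdd_eq_of_dvd`, and `PadicInt.appr`).
* `resOfLe_inf_conjH1_eq_zero_iff_of_mem` — **(DC-2)**: for `H ⊴ G`, `D ≤ G`, `τ ∈ D`, `s ∈ H¹(H, M)`: `res_{H ⊓ D}(conj_τ s) = 0 ↔ res_{H ⊓ D} s = 0`.
* `conjH1_pow_eq_self`, `conjH1_mul_pow_mul_eq` — plumbing.
* `forall_resOfLe_conjH1_eq_zero_iff_forall_lt` — **(DC-3₀)**: `(∀ σ, res_{ker κ ⊓ D_w}(conj_σ s) = 0) ↔ (∀ n < p^m, res_{ker κ ⊓ D_w}(conj_{γⁿ} s) = 0)`;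
  `…_iff_of_conjH1_eq`: for a `γ`-INVARIANT class the chosen place alone suffices.
* `mem_restrictedSelmerZp_iff_forall_lt` — **(DC-3)** (totally complex `K`, `awayKer = unramifiedKer` away from `p`): for `c` in the UNRAMIFIED group
  `S_M(K_∞) = datumSelmer (ker κ) M p (bdpData M p v̄) ∅`, `c ∈ 𝔖_v̄(K_∞, M) ↔ ∀ n < p^m, res_{ker κ ⊓ D_v̄}(conj_{γⁿ} c) = 0`.
* `resOfLe_conjH1_mem_localDefect_of_mem_datumSelmer` — **(DC-3a)**: those components lie in the local defect group
  `Def(κ, M, v̄) = ker (H¹(ker κ ⊓ D_v̄, M) → H¹(ker κ ⊓ I_v̄, M))` (-w6 g4's currency).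
* `finite_localDefect_of_finite_localDefect_vbar` — **(DC-4, generic)**: `S_M(K_∞) ⧸ 𝔖 ↪ Def^{p^m}`, hence `Finite Def → Finite (S_M(K_∞) ⧸ 𝔖)`.
Part 2 (`PrintCf2SplitBadTwoLineDoubleCosetFrame.lean`) instantiates on the road-α frames and proves `Finite Def` in CLASS (i) (inertial sign-mover).

[cite: NeukirchANT1999, Ch. I §9 (decomposition groups of the primes above `w` = double cosets)] [cite: Washington1997, §13.1 (ℤ_p-extensions)]
[cite: SerreGaloisCohomology1997, I §2.5 (conjugation on `H¹(H, M)`)] [cite: GreenbergVatsal2000, §2 pp. 16–17, 20–21] [cite: Agboola2007, §3 Prop. 3.2]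
-/

noncomputable section

set_option linter.dupNamespace false
set_option autoImplicit false

open scoped Classical

open NumberField IsDedekindDomain Field
open Literature.NumberTheory.EllipticCurves Literature.NumberTheory.EllipticCurves.GreenbergSelmer
open Literature.NumberTheory.GaloisRepresentations
open Summit.BirchSwinnertonDyer.BirchSwinnertonDyer.Theorems.AnomalousLocalTorsion

universe u

namespace Summit.BirchSwinnertonDyer.BirchSwinnertonDyer.Theorems.PrintCf2.LineDoubleCoset

/-! ## §1. (DC-1) `Γ_K = I_w · γ^{[0, p^m)} · ker κ` for a line ramified at `w` -/

section Decomposition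

variable {K : Type} [Field K] [NumberField K] {p : ℕ} [Fact p.Prime] (κ : ZpExtension K p)

/-- **(DC-1) Every `σ ∈ Γ_K` is `τ · γⁿ · h` with `τ ∈ I_w`, `n < p^m`, `h ∈ Gal(K̄/K_∞)`**, for a `ℤ_p`-line `κ` with an inertia element
`τ₁ ∈ I_w` of value `κ τ₁ ≠ 1` (valuation `m`) and a topological generator `γ` (`κ γ = 1`): write `κ σ = n + p^m y` with `n = appr_m(κ σ) < p^m`
and pick `τ ∈ I_w` with `κ τ = p^m y` (the image of the closed subgroup `I_w` is `ℤ_p`-saturated). So the primes of `K_∞` above `w`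
(double cosets `ker κ \ Γ_K / D_w`) are among the classes of `γ⁰, …, γ^{p^m − 1}`. [cite: Washington1997, §13.1] [cite: NeukirchANT1999, Ch. I §9] -/
theorem exists_eq_inertia_mul_pow_mul {w : HeightOneSpectrum (𝓞 K)} {τ₁ : absoluteGaloisGroup K}
    (hτ₁ : τ₁ ∈ GreenbergSelmer.inertia w) (hne : κ τ₁ ≠ 1) {γ : absoluteGaloisGroup K} (hγ : κ.IsTopGenerator γ)
    (σ : absoluteGaloisGroup K) :
    ∃ (τ : absoluteGaloisGroup K) (n : ℕ) (h : absoluteGaloisGroup K),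
      τ ∈ GreenbergSelmer.inertia w ∧ n < p ^ ((κ τ₁).toAdd).valuation ∧ h ∈ κ.kerSubgroup ∧ σ = τ * γ ^ n * h := by
  set m : ℕ := ((κ τ₁).toAdd).valuation with hm
  set a : ℤ_[p] := (κ σ).toAdd with ha
  have hdvd : (p : ℤ_[p]) ^ m ∣ a - (PadicInt.appr a m : ℤ_[p]) := Ideal.mem_span_singleton.mp (PadicInt.appr_spec m a)
  obtain ⟨τ, hτI, hτ⟩ := exists_mem_apply_toAdd_eq_of_dvd κ (GreenbergSelmer.inertia w) (isClosed_inertia' w) hτ₁ hne hdvd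
  refine ⟨τ, PadicInt.appr a m, (τ * γ ^ PadicInt.appr a m)⁻¹ * σ, hτI, PadicInt.appr_lt a m, ?_, by group⟩
  rw [ZpExtension.mem_kerSubgroup, map_mul, map_inv, map_mul, map_pow, hγ]
  apply Multiplicative.toAdd.injective
  rw [toAdd_mul, toAdd_inv, toAdd_mul, toAdd_pow, toAdd_ofAdd, hτ, toAdd_one, ← ha]
  simp only [nsmul_eq_mul, mul_one]
  ring

end Decomposition

/-! ## §2. (DC-2) Restriction to `H ⊓ D` of a conjugate by an element of `D` -/

section Conj

variable {G : Type u} [Group G] [TopologicalSpace G] [IsTopologicalGroup G]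
  (M : Type u) [AddCommGroup M] [DistribMulAction G M] [TopologicalSpace M] [DiscreteTopology M]
  (H D : Subgroup G) [H.Normal]

/-- **(DC-2, one direction)**: for `τ ∈ D`, if `s ∈ H¹(H, M)` dies on `H ⊓ D` then so does `conj_τ s` — on a cocycle `z` with
`z(x) = x a₀ − a₀` on `H ⊓ D`, `τ • z(τ⁻¹ x τ) = x (τ a₀) − τ a₀` because `τ⁻¹ x τ ∈ H ⊓ D`. [cite: SerreGaloisCohomology1997, I §2.5] -/
theorem resOfLe_inf_conjH1_eq_zero_of_mem {τ : G} (hτ : τ ∈ D) (s : subgroupH1 H M)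
    (hs : resOfLe M (inf_le_left : H ⊓ D ≤ H) s = 0) :
    resOfLe M (inf_le_left : H ⊓ D ≤ H) (conjH1 H M τ s) = 0 := by
  obtain ⟨z, rfl⟩ := oneCocycleClass_surjective _ s
  obtain ⟨a₀, ha₀⟩ := (CocycleCriteria.resOfLe_oneCocycleClass_eq_zero_iff (inf_le_left : H ⊓ D ≤ H) z).mp hs
  refine (CocycleCriteria.conjH1_oneCocycleClass_mem_ker_resOfLe_iff (inf_le_left : H ⊓ D ≤ H) τ z).mpr ⟨τ • a₀, fun x ↦ ?_⟩
  have hx' : τ⁻¹ * (x : G) * τ ∈ H ⊓ D :=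
    Subgroup.mem_inf.mpr ⟨conj_mem_of_normal H τ ⟨(x : G), (Subgroup.mem_inf.mp x.2).1⟩,
      D.mul_mem (D.mul_mem (D.inv_mem hτ) (Subgroup.mem_inf.mp x.2).2) hτ⟩
  have heq : subgroupConj H τ (Subgroup.inclusion (inf_le_left : H ⊓ D ≤ H) x) =
      Subgroup.inclusion (inf_le_left : H ⊓ D ≤ H) ⟨τ⁻¹ * (x : G) * τ, hx'⟩ := Subtype.ext rfl
  rw [heq, ha₀]
  change τ • ((τ⁻¹ * (x : G) * τ) • a₀ - a₀) = (x : G) • τ • a₀ - τ • a₀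
  rw [smul_sub, smul_smul, smul_smul, ← mul_assoc, ← mul_assoc, mul_inv_cancel, one_mul]

/-- **(DC-2)**: for `τ ∈ D` and `s ∈ H¹(H, M)`, `res_{H ⊓ D}(conj_τ s) = 0 ↔ res_{H ⊓ D} s = 0` (the converse by conjugating back with
`τ⁻¹ ∈ D`: `conj_{τ⁻¹} ∘ conj_τ = conj_1 = id`). [cite: SerreGaloisCohomology1997, I §2.5] -/
theorem resOfLe_inf_conjH1_eq_zero_iff_of_mem {τ : G} (hτ : τ ∈ D) (s : subgroupH1 H M) :
    resOfLe M (inf_le_left : H ⊓ D ≤ H) (conjH1 H M τ s) = 0 ↔ resOfLe M (inf_le_left : H ⊓ D ≤ H) s = 0 := by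
  refine ⟨fun h ↦ ?_, resOfLe_inf_conjH1_eq_zero_of_mem M H D hτ s⟩
  have h' := resOfLe_inf_conjH1_eq_zero_of_mem M H D (D.inv_mem hτ) _ h
  have hcomp : conjH1 H M τ⁻¹ (conjH1 H M τ s) = s := by
    rw [← AddMonoidHom.comp_apply, ← conjH1_mul_holds H M, inv_mul_cancel, conjH1_one_holds H M, AddMonoidHom.id_apply]
  rwa [hcomp] at h'

/-- Plumbing: a `γ`-invariant class is `γⁿ`-invariant. [folklore] -/
theorem conjH1_pow_eq_self {γ : G} {s : subgroupH1 H M} (hs : conjH1 H M γ s = s) (n : ℕ) : conjH1 H M (γ ^ n) s = s := by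
  induction n with
  | zero => rw [pow_zero, conjH1_one_holds H M, AddMonoidHom.id_apply]
  | succ n ih => rw [pow_succ, conjH1_mul_holds H M, AddMonoidHom.comp_apply, hs, ih]

/-- Plumbing: `conj_{τ γⁿ h} s = conj_τ (conj_{γⁿ} s)` for `h ∈ H` (inner automorphisms act trivially, `conjH1_of_mem_holds`). [folklore]
[cite: SerreLocalFields1979, VII §5 Prop. 3] -/
theorem conjH1_mul_pow_mul_eq (τ γ : G) (n : ℕ) {h : G} (hh : h ∈ H) (s : subgroupH1 H M) :
    conjH1 H M (τ * γ ^ n * h) s = conjH1 H M τ (conjH1 H M (γ ^ n) s) := by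
  rw [conjH1_mul_holds H M, conjH1_mul_holds H M, AddMonoidHom.comp_apply, AddMonoidHom.comp_apply, conjH1_of_mem_holds H M hh,
    AddMonoidHom.id_apply]

end Conj

/-! ## §3. (DC-3₀) Over the line: the condition at every conjugate ⟺ at `p^m` conjugates -/

section Line

variable {K : Type} [Field K] [NumberField K] {p : ℕ} [Fact p.Prime] (κ : ZpExtension K p)
  (M : Type) [AddCommGroup M] [DistribMulAction (absoluteGaloisGroup K) M] [TopologicalSpace M] [DiscreteTopology M]

/-- **(DC-3₀) Strictness at every prime of `K_∞` above `w` is strictness at `p^m` conjugates.** For a `ℤ_p`-line `κ` with `τ₁ ∈ I_w`,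
`κ τ₁ ≠ 1` (valuation `m`), a topological generator `γ`, and any class `s ∈ H¹(Gal(K̄/K_∞), M)`:
`(∀ σ ∈ Γ_K, res_{ker κ ⊓ D_w}(conj_σ s) = 0) ↔ (∀ n < p^m, res_{ker κ ⊓ D_w}(conj_{γⁿ} s) = 0)` — (DC-1) + (DC-2) + `conj_h = id` for
`h ∈ ker κ`. [cite: NeukirchANT1999, Ch. I §9] [cite: SerreGaloisCohomology1997, I §2.5] -/
theorem forall_resOfLe_conjH1_eq_zero_iff_forall_lt {w : HeightOneSpectrum (𝓞 K)} {τ₁ : absoluteGaloisGroup K}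
    (hτ₁ : τ₁ ∈ GreenbergSelmer.inertia w) (hne : κ τ₁ ≠ 1) {γ : absoluteGaloisGroup K} (hγ : κ.IsTopGenerator γ)
    (s : subgroupH1 κ.kerSubgroup M) :
    (∀ σ : absoluteGaloisGroup K,
        resOfLe M (inf_le_left : κ.kerSubgroup ⊓ decomp w ≤ κ.kerSubgroup) (conjH1 κ.kerSubgroup M σ s) = 0) ↔
      ∀ n : ℕ, n < p ^ ((κ τ₁).toAdd).valuation →
        resOfLe M (inf_le_left : κ.kerSubgroup ⊓ decomp w ≤ κ.kerSubgroup) (conjH1 κ.kerSubgroup M (γ ^ n) s) = 0 := by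
  refine ⟨fun h n _ ↦ h (γ ^ n), fun h σ ↦ ?_⟩
  obtain ⟨τ, n, h', hτ, hn, hh', rfl⟩ := exists_eq_inertia_mul_pow_mul κ hτ₁ hne hγ σ
  rw [conjH1_mul_pow_mul_eq M κ.kerSubgroup τ γ n hh',
    resOfLe_inf_conjH1_eq_zero_iff_of_mem M κ.kerSubgroup (decomp w) (GreenbergSelmer.inertia_le_decomp w hτ)]
  exact h n hn

/-- **For a `γ`-INVARIANT class the chosen place suffices**: if `conj_γ s = s` then
`(∀ σ, res_{ker κ ⊓ D_w}(conj_σ s) = 0) ↔ res_{ker κ ⊓ D_w} s = 0` (line ramified at `w`). [cite: NeukirchANT1999, Ch. I §9]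
[cite: SerreGaloisCohomology1997, I §2.5] -/
theorem forall_resOfLe_conjH1_eq_zero_iff_of_conjH1_eq {w : HeightOneSpectrum (𝓞 K)} {τ₁ : absoluteGaloisGroup K}
    (hτ₁ : τ₁ ∈ GreenbergSelmer.inertia w) (hne : κ τ₁ ≠ 1) {γ : absoluteGaloisGroup K} (hγ : κ.IsTopGenerator γ)
    {s : subgroupH1 κ.kerSubgroup M} (hs : conjH1 κ.kerSubgroup M γ s = s) :
    (∀ σ : absoluteGaloisGroup K,
        resOfLe M (inf_le_left : κ.kerSubgroup ⊓ decomp w ≤ κ.kerSubgroup) (conjH1 κ.kerSubgroup M σ s) = 0) ↔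
      resOfLe M (inf_le_left : κ.kerSubgroup ⊓ decomp w ≤ κ.kerSubgroup) s = 0 := by
  rw [forall_resOfLe_conjH1_eq_zero_iff_forall_lt κ M hτ₁ hne hγ s]
  refine ⟨fun h ↦ ?_, fun h n _ ↦ ?_⟩
  · have h0 := h 0 (pow_pos (Nat.Prime.pos Fact.out) _)
    rwa [pow_zero, conjH1_one_holds κ.kerSubgroup M, AddMonoidHom.id_apply] at h0
  · rwa [conjH1_pow_eq_self M κ.kerSubgroup hs n]

end Line


/-! ## §4. Over the line, generically: strictness at `p^m` conjugates and the embedding `S/𝔖 ↪ Def^{p^m}` -/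

section LineSelmer

open Literature.NumberTheory.EllipticCurves.Agboola2007 Literature.NumberTheory.EllipticCurves.GreenbergVatsal2000

variable {K : Type} [Field K] [NumberField K] {p : ℕ} [Fact p.Prime] (κ : ZpExtension K p)
  (M : Type) [AddCommGroup M] [DistribMulAction (absoluteGaloisGroup K) M] [TopologicalSpace M] [DiscreteTopology M]

/-- **(DC-3, generic) AGBOOLA'S STRICTNESS AT `p^m` CONJUGATES.** `K` totally complex, `κ` a `ℤ_p`-line with topological generator `γ` and a
ramified inertia witness `τ₁ ∈ I_v̄` (`κ τ₁ ≠ 1`, valuation `m`), and suppose Agboola's «locally trivial» and Greenberg–Vatsal's «unramified» agree at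
every `w ∤ p` over the line (`haway`; -w6 g4 `awayKer_eq_unramifiedKer_of_frame` on road α). Then a class `c` of the UNRAMIFIED group
`S_M(K_∞) = datumSelmer (ker κ) M p (bdpData M p v̄) ∅` lies in `𝔖_v̄(K_∞, M) = restrictedSelmerZp κ M v̄` iff `res_{ker κ ⊓ D_v̄}(conj_{γⁿ} c) = 0` for the
`p^m` exponents `n < p^m` (complex places impose nothing; the strict condition at every conjugate reduces to these by (DC-3₀)).
[cite: Agboola2007, §3 (arXiv p0008:L58–80)] [cite: GreenbergVatsal2000, §2 p. 17] [cite: NeukirchANT1999, Ch. I §9] -/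
theorem mem_restrictedSelmerZp_iff_forall_lt [IsTotallyComplex K] {vbar : HeightOneSpectrum (𝓞 K)}
    (haway : ∀ w : HeightOneSpectrum (𝓞 K), ((p : ℕ) : 𝓞 K) ∉ w.asIdeal →
      GreenbergSelmer.awayKer κ.kerSubgroup M w = unramifiedKer κ.kerSubgroup M w)
    {γ : absoluteGaloisGroup K} (hγ : κ.IsTopGenerator γ) {τ₁ : absoluteGaloisGroup K} (hτ₁ : τ₁ ∈ GreenbergSelmer.inertia vbar)
    (hne : κ τ₁ ≠ 1) {c : subgroupH1 κ.kerSubgroup M} (hc : c ∈ datumSelmer κ.kerSubgroup M p (Castella2018.AcSelmer.bdpData M p vbar) ∅) :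
    c ∈ restrictedSelmerZp κ M vbar ↔
      ∀ n : ℕ, n < p ^ ((κ τ₁).toAdd).valuation →
        resOfLe M (inf_le_left : κ.kerSubgroup ⊓ decomp vbar ≤ κ.kerSubgroup) (conjH1 κ.kerSubgroup M (γ ^ n) c) = 0 := by
  rw [← forall_resOfLe_conjH1_eq_zero_iff_forall_lt κ M hτ₁ hne hγ c, restrictedSelmerZp_eq, Castella2018.AcSelmer.mem_selmerOver_iff]
  rw [mem_datumSelmer_iff, mem_unramifiedOutside_iff] at hc
  constructor
  · rintro ⟨-, -, hstr⟩ σ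
    have h := hstr σ
    rwa [BigGaloisRep.strictKer_strictDatum_eq_awayKer, GreenbergSelmer.awayKer, AddMonoidHom.mem_ker] at h
  · intro h
    refine ⟨fun w hw _ σ ↦ ?_, fun w σ ↦ BigGaloisRep.mem_infKer_of_isComplex _ _ (IsTotallyComplex.isComplex w) _, fun σ ↦ ?_⟩
    · rw [haway w hw]
      exact hc.1 w (Set.notMem_empty w) hw σ
    · rw [BigGaloisRep.strictKer_strictDatum_eq_awayKer, GreenbergSelmer.awayKer, AddMonoidHom.mem_ker]
      exact h σ

/-- **(DC-3a) The components are UNRAMIFIED local classes.** For `c ∈ S_M(K_∞) = datumSelmer (ker κ) M p (bdpData M p v̄) ∅` and any `σ ∈ Γ_K`,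
`res_{ker κ ⊓ D_v̄}(conj_σ c)` lies in the local defect group `Def(κ, M, v̄) := ker (H¹(ker κ ⊓ D_v̄, M) → H¹(ker κ ⊓ I_v̄, M))` (-w6 g4's currency,
2026-08-29T02:44:26Z): `conj_σ c ∈ S_M(K_∞)` is unramified at the chosen place above `v̄`.
[cite: GreenbergVatsal2000, §2 pp. 16–17] [cite: Greenberg1989, §1 p. 98 (4)] -/
theorem resOfLe_conjH1_mem_localDefect_of_mem_datumSelmer {vbar : HeightOneSpectrum (𝓞 K)} (hvbar : ((p : ℕ) : 𝓞 K) ∈ vbar.asIdeal)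
    {c : subgroupH1 κ.kerSubgroup M} (hc : c ∈ datumSelmer κ.kerSubgroup M p (Castella2018.AcSelmer.bdpData M p vbar) ∅)
    (σ : absoluteGaloisGroup K) :
    resOfLe M (inf_le_left : κ.kerSubgroup ⊓ decomp vbar ≤ κ.kerSubgroup) (conjH1 κ.kerSubgroup M σ c) ∈
      (resOfLe M (inf_le_inf_left κ.kerSubgroup (GreenbergSelmer.inertia_le_decomp vbar) :
        κ.kerSubgroup ⊓ GreenbergSelmer.inertia vbar ≤ κ.kerSubgroup ⊓ decomp vbar)).ker := by
  have hc' : conjH1 κ.kerSubgroup M σ c ∈ datumSelmer κ.kerSubgroup M p (Castella2018.AcSelmer.bdpData M p vbar) ∅ :=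
    conjH1_mem_datumSelmer κ.kerSubgroup M p _ ∅ σ hc
  have hgr := ((mem_datumSelmer_iff _).mp hc').2 vbar hvbar 1
  rw [conjH1_one_holds κ.kerSubgroup M, AddMonoidHom.id_apply, Castella2018.AcSelmer.bdpData_self,
    mem_greenbergKer_strictDatum_iff_resOfLe] at hgr
  rw [AddMonoidHom.mem_ker, ← AddMonoidHom.comp_apply, Literature.NumberTheory.EllipticCurves.resOfLe_comp_holds]
  exact hgr

/-- **(DC-4, generic) `S_M(K_∞) ⧸ 𝔖_v̄(K_∞, M)` EMBEDS IN `Def^{p^m}`; in particular it is FINITE when `Def` is.** Under the hypotheses of (DC-3), the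
additive map `c ↦ (res_{ker κ ⊓ D_v̄}(conj_{γⁿ} c))_{n < p^m}` from the unramified group `KellerYin2024.unrSelmer κ M v̄ ∅` to `Def^{p^m}` has kernel
`𝔖_v̄(K_∞, M)`, so `Finite Def → Finite (S_M(K_∞) ⧸ 𝔖)`. (The index set `n < p^m` over-counts the primes of `K_∞` above `v̄` — the double cosets
`ker κ \ Γ_K / D_v̄ ≅ ℤ_p / κ(D_v̄)` — which is harmless for the kernel.) [cite: GreenbergVatsal2000, §2 pp. 17, 20–21] [cite: Agboola2007, §3 Prop. 3.2]
[cite: NeukirchANT1999, Ch. I §9] -/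
theorem finite_localDefect_of_finite_localDefect_vbar [IsTotallyComplex K] {vbar : HeightOneSpectrum (𝓞 K)}
    (hvbar : ((p : ℕ) : 𝓞 K) ∈ vbar.asIdeal)
    (haway : ∀ w : HeightOneSpectrum (𝓞 K), ((p : ℕ) : 𝓞 K) ∉ w.asIdeal →
      GreenbergSelmer.awayKer κ.kerSubgroup M w = unramifiedKer κ.kerSubgroup M w)
    {γ : absoluteGaloisGroup K} (hγ : κ.IsTopGenerator γ) {τ₁ : absoluteGaloisGroup K} (hτ₁ : τ₁ ∈ GreenbergSelmer.inertia vbar)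
    (hne : κ τ₁ ≠ 1)
    [Finite ↥(resOfLe M (inf_le_inf_left κ.kerSubgroup (GreenbergSelmer.inertia_le_decomp vbar) :
        κ.kerSubgroup ⊓ GreenbergSelmer.inertia vbar ≤ κ.kerSubgroup ⊓ decomp vbar)).ker] :
    Finite (↥(KellerYin2024.unrSelmer κ M vbar ∅) ⧸
      (restrictedSelmerZp κ M vbar).addSubgroupOf (KellerYin2024.unrSelmer κ M vbar ∅)) := by
  have hmemS : ∀ c : ↥(KellerYin2024.unrSelmer κ M vbar ∅),
      (c : subgroupH1 κ.kerSubgroup M) ∈ datumSelmer κ.kerSubgroup M p (Castella2018.AcSelmer.bdpData M p vbar) ∅ := fun c ↦ c.2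
  -- the map `c ↦ (res_{ker κ ⊓ D_v̄}(conj_{γⁿ} c))_{n < p^m}` into the finite group `Def^{p^m}`
  let Ψ : ↥(KellerYin2024.unrSelmer κ M vbar ∅) →+
      (Fin (p ^ ((κ τ₁).toAdd).valuation) →
        ↥(resOfLe M (inf_le_inf_left κ.kerSubgroup (GreenbergSelmer.inertia_le_decomp vbar) :
          κ.kerSubgroup ⊓ GreenbergSelmer.inertia vbar ≤ κ.kerSubgroup ⊓ decomp vbar)).ker) :=
    { toFun := fun c n ↦ ⟨resOfLe M (inf_le_left : κ.kerSubgroup ⊓ decomp vbar ≤ κ.kerSubgroup)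
          (conjH1 κ.kerSubgroup M (γ ^ (n : ℕ)) (c : subgroupH1 κ.kerSubgroup M)),
        resOfLe_conjH1_mem_localDefect_of_mem_datumSelmer κ M hvbar (hmemS c) _⟩
      map_zero' := by
        funext n
        exact Subtype.ext (by simp only [Pi.zero_apply, ZeroMemClass.coe_zero, map_zero])
      map_add' := fun a b ↦ by
        funext n
        exact Subtype.ext (by simp only [Pi.add_apply, AddSubgroup.coe_add, map_add]) }
  have hΨ : ∀ (c : ↥(KellerYin2024.unrSelmer κ M vbar ∅)) (n : Fin (p ^ ((κ τ₁).toAdd).valuation)),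
      ((Ψ c n : ↥(resOfLe M (inf_le_inf_left κ.kerSubgroup (GreenbergSelmer.inertia_le_decomp vbar) :
          κ.kerSubgroup ⊓ GreenbergSelmer.inertia vbar ≤ κ.kerSubgroup ⊓ decomp vbar)).ker) : subgroupH1 (κ.kerSubgroup ⊓ decomp vbar) M) =
        resOfLe M (inf_le_left : κ.kerSubgroup ⊓ decomp vbar ≤ κ.kerSubgroup)
          (conjH1 κ.kerSubgroup M (γ ^ (n : ℕ)) (c : subgroupH1 κ.kerSubgroup M)) := fun _ _ ↦ rfl
  -- its kernel lies in `𝔖` by (DC-3)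
  have hker : Ψ.ker ≤ (restrictedSelmerZp κ M vbar).addSubgroupOf (KellerYin2024.unrSelmer κ M vbar ∅) := by
    intro c hc
    rw [AddSubgroup.mem_addSubgroupOf]
    refine (mem_restrictedSelmerZp_iff_forall_lt κ M haway hγ hτ₁ hne (hmemS c)).mpr fun n hn ↦ ?_
    rw [← hΨ c ⟨n, hn⟩, (AddMonoidHom.mem_ker).mp hc, Pi.zero_apply, ZeroMemClass.coe_zero]
  -- finiteness
  haveI : Finite (↥(KellerYin2024.unrSelmer κ M vbar ∅) ⧸ Ψ.ker) :=
    Finite.of_equiv _ (QuotientAddGroup.quotientKerEquivRange Ψ).symm.toEquiv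
  have hker' : Ψ.ker ≤ (QuotientAddGroup.mk' ((restrictedSelmerZp κ M vbar).addSubgroupOf (KellerYin2024.unrSelmer κ M vbar ∅))).ker := by
    rw [QuotientAddGroup.ker_mk']
    exact hker
  refine Finite.of_surjective (QuotientAddGroup.lift Ψ.ker (QuotientAddGroup.mk' _) hker') fun q ↦ ?_
  obtain ⟨x, rfl⟩ := QuotientAddGroup.mk'_surjective _ q
  exact ⟨QuotientAddGroup.mk x, QuotientAddGroup.lift_mk _ hker' x⟩

end LineSelmer

end Summit.BirchSwinnertonDyer.BirchSwinnertonDyer.Theorems.PrintCf2.LineDoubleCoset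

end
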